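import Literature.Topology.FourManifolds.MappingTorusSmoothProofs
import Literature.Topology.FourManifolds.OpenGluingCounterexample
import Mathlib.Analysis.Calculus.LocalExtr.Basic
import HarnessLib

/-!
# A counterexample: the named fact `Literature.Topology.FourManifolds.IsMappingTorusOf.of_diffeomorph` is false

`Literature.Topology.FourManifolds.IsMappingTorusOf.of_diffeomorph` (file `MappingTorus`) asserts that a smooth mapping torus
structure `IsMappingTorusOf IT T φ` (an open gluing of the cylinders `M × (0, 1)`,
`M × (1/2, 3/2)` along `mappingTorusRel φ`) is transported along any diffeomorphism
`T ≃ₘ⟮IT, IT'⟯ T'` for two *arbitrary* models with corners `IT : ModelWithCorners ℝ ET HT`,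
`IT' : ModelWithCorners ℝ ET HT'` on the same vector space `ET`. This file proves that this
statement is **false**
(`Literature.Topology.FourManifolds.MappingTorusTransportCounterexample.not_isMappingTorusOf_of_diffeomorph`), so that the fact
must not be discharged or instantiated in general. It has the same shape as the
named fact `Literature.Topology.FourManifolds.IsOpenGluing.of_diffeomorph` its interim proof relied on, refuted in
`OpenGluingCounterexample` (whose elementary lemmas on the parabola region we reuse); the present
file shows that the specialisation to mapping tori does not rescue it. The corrected statement,
proved, is already in the tree: `Literature.Topology.FourManifolds.IsMappingTorusOf.of_diffeomorph_of_range_eq` (file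
`MappingTorusTransportProofs`, hypothesis `range IT' = range IT`; dot-notation form
`IsMappingTorusOf.diffeomorph_comp`), together with the true instances
`IsMappingTorusOf.of_diffeomorph_holds_of_range_eq`, `…_holds_self`, `…_holds_of_boundaryless` of
the named fact. In the source (Cappell–Shaneson, *Some new four-manifolds*, Ann. of Math. 104
(1976), §1) the mapping tori are those of self-diffeomorphisms of the `3`-torus, smooth manifolds
with the one standard model, so that `IT' = IT` and transport along diffeomorphisms is immediate
(`…_holds_self`); the two-arbitrary-models generality is an artefact of the relational
formalisation, not a claim in print.

## The counterexample

* The fibre is the half-line `ℝ≥0 = [0, ∞)` (model `modelHalfLine`, the inclusion into `ℝ`;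
  the simplest manifold with nonempty boundary) and `φ₀ = Diffeomorph.refl`. Its topological
  mapping torus `Tor := MappingTorus φ₀` (a half-open annulus `[0, ∞) × 𝕊¹`) carries the
  `C^∞` atlas glued from the product atlases of the two cylinders (`MappingTorus.isManifold`,
  file `MappingTorusSmoothProofs`) for the product model `modelTor := modelHalfLine.prod 𝓘(ℝ, ℝ)`
  on `ℝ × ℝ`, whose range is the half-plane `{0 ≤ u}`, and *is* a smooth mapping torus of `φ₀`
  for it (`isMappingTorusOf_tor`, from `MappingTorus.isMappingTorusOf`).
* `bend : ℝ² ≃ₘ ℝ²`, `(u, v) ↦ (v, u + v²)`, maps the half-plane onto the parabola region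
  `{x² ≤ y}` (convex). Re-modelling along it (`transDiffeomorph`, see below) gives a second model
  `modelTor' := bend ∘ modelTor` on the *same* model space `ModelProd ℝ≥0 ℝ`, for which `Tor`
  is still a `C^∞` manifold (`isManifold_transDiffeomorph`) and the identity is a diffeomorphism
  `torDiffeo : Tor ≃ₘ⟮modelTor, modelTor'⟯ Tor` (`toTransDiffeomorph`).
* `not_isMappingTorusOf_tor'`: `Tor` is *not* a smooth mapping torus of `φ₀` for `modelTor'`.
  The first gluing map `j : ℝ≥0 × (0, 1) → Tor` would be an open `C^∞` embedding, in
  particular a Mathlib immersion at the boundary point `basePt = (0, 1/2)`: charts `φ` (cylinder,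
  maximal atlas of `modelTor`) and `ψ` (`Tor`, maximal atlas of `modelTor'`) and a linear
  equivalence `L` with `ψ ∘ j ∘ φ⁻¹ = L ∘ (·, 0)` on the target `V ⊆ {0 ≤ u}` of `φ`. Then
  (Step 1, `linPart_surjective`) `u ↦ L (u, 0)` is a linear automorphism of `ℝ²` (its range
  contains an open piece of the parabola region, `j` being open); (Step 2,
  `fst_extend_basePt_eq_zero`) `φ basePt` lies on the boundary line `{u = 0}` (else `φ⁻¹`
  followed by the coordinates `(x, s)` of the cylinder would be differentiable near `φ basePt`
  with first component `≥ 0` vanishing there, forcing a singular derivative, contradicting the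
  chart being a within-differentiable left inverse); (Step 3, `linPart_boundary_mem_parabola`,
  `false_of_isImmersionAt`) the points `(0, y)` of the boundary line near `φ basePt` lie in `V`
  and are mapped by the linear automorphism to boundary points of the parabola region, i.e. onto
  the parabola `x² = y` — but a linear map cannot take a segment into a parabola.
* `not_isMappingTorusOf_of_diffeomorph`: hence the instance `I := modelHalfLine`,
  `IT := modelTor`, `IT' := modelTor'`, `T = T' := Tor` of the named fact fails.

The root cause is that of `OpenGluingCounterexample`: Mathlib's `IsImmersionAt` asks for charts of
the maximal atlases in which the map is *linear*, so the germs of `range (I.prod 𝓘(ℝ, ℝ))` and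
`range IT'` at corresponding boundary points must be linearly equivalent, whereas a diffeomorphism
between differently modelled manifolds only matches the model ranges by a within-smooth
homeomorphism.

## Re-modelling along a diffeomorphism of the model vector space

The tool of the second bullet is general and kept in the namespace `Literature`: for a model with
corners `I : ModelWithCorners ℝ E H` and a diffeomorphism `σ : E ≃ₘ[ℝ] E` with `σ '' range I`
convex, `Literature.transDiffeomorph I σ _` is the model `σ ∘ I` on the same model space `H`; a `C^∞`
manifold for `I` is one for `transDiffeomorph I σ _` (`isManifold_transDiffeomorph`), and the
identity map is a diffeomorphism between the two structures (`toTransDiffeomorph`). This is the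
nonlinear analogue of Mathlib's `ModelWithCorners.transContinuousLinearEquiv` /
`ContinuousLinearEquiv.toTransContinuousLinearEquiv` (Mathlib formerly offered
`ModelWithCorners.transDiffeomorph` for an arbitrary diffeomorphism of the model vector space;
since models with corners over `ℝ` are now required to have convex range, the convexity of
`σ '' range I` has to be assumed).

Everything here is elementary real analysis and is proved; no source prints this construction
(it is ours), so all declarations are tagged folklore. The instances declared (`ChartedSpace`,
`IsManifold` on the new type `Tor`) concern only the types defined in this file.

## References
* S. E. Cappell, J. L. Shaneson, *Some new four-manifolds*, Ann. of Math. 104 (1976), §1 (the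
  setting of the named fact: mapping tori of self-diffeomorphisms of closed manifolds).
  [cite: CappellShaneson1976, §1]
-/

open scoped Manifold ContDiff Topology NNReal
open Set Function

noncomputable section

namespace Literature.Topology.FourManifolds

/-! ### Re-modelling a manifold along a diffeomorphism of the model vector space -/

section TransDiffeomorph

variable {E H : Type*} [NormedAddCommGroup E] [NormedSpace ℝ E] [TopologicalSpace H]

/-- **Re-modelling along a diffeomorphism of the model vector space.** Given a model with corners
`I : H → E` over `ℝ` and a `C^∞` diffeomorphism `σ` of `E` such that `σ '' range I` is still
convex, `transDiffeomorph I σ hconv : H → E` is the model with corners `σ ∘ I` (inverse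
`I.symm ∘ σ.symm`, source `univ`, range `σ '' range I`). This is the nonlinear analogue of
Mathlib's `ModelWithCorners.transContinuousLinearEquiv` (Mathlib's models with corners over `ℝ`
have convex range, field `convex_range'`, whence the hypothesis `hconv`). A manifold modelled on
`I` is also a manifold modelled on `transDiffeomorph I σ hconv` (`isManifold_transDiffeomorph`),
and the identity is a diffeomorphism between the two (`toTransDiffeomorph`). [folklore] -/
def transDiffeomorph (I : ModelWithCorners ℝ E H) (σ : E ≃ₘ[ℝ] E)
    (hconv : Convex ℝ (σ '' range I)) : ModelWithCorners ℝ E H :=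
  ModelWithCorners.ofConvexRange
    { toFun := σ ∘ I
      invFun := I.symm ∘ σ.symm
      source := univ
      target := σ '' range I
      map_source' := fun x _ => ⟨I x, mem_range_self x, rfl⟩
      map_target' := fun _ _ => mem_univ _
      left_inv' := fun x _ => by simp
      right_inv' := by
        rintro _ ⟨_, ⟨x, rfl⟩, rfl⟩
        simp }
    rfl hconv (σ.continuous.comp I.continuous) (I.continuous_symm.comp σ.symm.continuous)
    (by
      change (interior (σ.toHomeomorph '' range I)).Nonempty
      rw [← σ.toHomeomorph.image_interior]
      exact I.nonempty_interior.image _)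

variable (I : ModelWithCorners ℝ E H) (σ : E ≃ₘ[ℝ] E) (hconv : Convex ℝ (σ '' range I))

/-- The re-modelled model with corners is `σ ∘ I`. [folklore] -/
@[simp, mfld_simps] theorem coe_transDiffeomorph :
    ⇑(transDiffeomorph I σ hconv) = σ ∘ I := rfl

/-- The inverse of the re-modelled model with corners is `I.symm ∘ σ.symm`. [folklore] -/
@[simp, mfld_simps] theorem coe_transDiffeomorph_symm :
    ⇑(transDiffeomorph I σ hconv).symm = I.symm ∘ σ.symm := rfl

/-- The range of the re-modelled model with corners is `σ '' range I`. [folklore] -/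
theorem range_transDiffeomorph :
    range (transDiffeomorph I σ hconv) = σ '' range I := by
  rw [coe_transDiffeomorph, range_comp]

variable {M : Type*} [TopologicalSpace M] [ChartedSpace H M]

/-- Extended charts for the re-modelled model: `σ ∘ extChartAt I x`. [folklore] -/
theorem coe_extChartAt_transDiffeomorph (x : M) :
    ⇑(extChartAt (transDiffeomorph I σ hconv) x) = σ ∘ extChartAt I x := rfl

/-- Inverse extended charts for the re-modelled model: `(extChartAt I x).symm ∘ σ.symm`.
[folklore] -/
theorem coe_extChartAt_transDiffeomorph_symm (x : M) :
    ⇑(extChartAt (transDiffeomorph I σ hconv) x).symm = (extChartAt I x).symm ∘ σ.symm := rfl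

/-- Targets of the extended charts for the re-modelled model. [folklore] -/
theorem extChartAt_transDiffeomorph_target (x : M) :
    (extChartAt (transDiffeomorph I σ hconv) x).target = σ.symm ⁻¹' (extChartAt I x).target := by
  ext y
  simp only [extChartAt, OpenPartialHomeomorph.extend_target, mem_inter_iff, mem_preimage,
    coe_transDiffeomorph_symm, comp_apply,
    range_transDiffeomorph]
  refine and_congr_right fun _ => ⟨?_, fun hy => ⟨σ.symm y, hy, by simp⟩⟩
  rintro ⟨z, hz, rfl⟩
  simpa using hz

/-- **A `C^∞` manifold modelled on `I` is a `C^∞` manifold modelled on `transDiffeomorph I σ _`**: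
the coordinate changes for the new model are the conjugates by `σ` of the old ones (cf. Mathlib's
instance for `transContinuousLinearEquiv`, the linear case). A theorem, not an instance (the
model is not inferrable). [folklore] -/
theorem isManifold_transDiffeomorph [IsManifold I ∞ M] :
    IsManifold (transDiffeomorph I σ hconv) ∞ M := by
  refine isManifold_of_contDiffOn _ _ _ fun e₁ e₂ h₁ h₂ => ?_
  have hc := ((contDiffGroupoid ∞ I).compatible h₁ h₂).1
  have h1 : ContDiffOn ℝ ∞ ((I ∘ (e₁.symm ≫ₕ e₂) ∘ I.symm) ∘ σ.symm)
      ((transDiffeomorph I σ hconv).symm ⁻¹' (e₁.symm ≫ₕ e₂).source ∩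
        range (transDiffeomorph I σ hconv)) := by
    refine hc.comp σ.symm.contDiff.contDiffOn ?_
    rintro y ⟨hy1, hy2⟩
    rw [range_transDiffeomorph] at hy2
    obtain ⟨z, hz, rfl⟩ := hy2
    refine ⟨?_, by simpa using hz⟩
    simpa [coe_transDiffeomorph_symm] using hy1
  exact (σ.contDiff.comp_contDiffOn h1).congr fun y _ => by simp [comp_apply]

/-- **The identity is a diffeomorphism between a manifold modelled on `I` and the same manifold
modelled on `transDiffeomorph I σ _`** (in extended charts it reads `σ`, resp. `σ.symm`; cf.
Mathlib's `ContinuousLinearEquiv.toTransContinuousLinearEquiv` for the linear case). [folklore] -/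
def toTransDiffeomorph : M ≃ₘ⟮I, transDiffeomorph I σ hconv⟯ M where
  toEquiv := Equiv.refl M
  contMDiff_toFun x := by
    refine contMDiffWithinAt_iff'.2 ⟨continuousWithinAt_id, ?_⟩
    refine σ.contDiff.contDiffWithinAt.congr_of_mem (fun y hy => ?_) ?_
    · simp only [Equiv.coe_refl, id, (· ∘ ·), coe_extChartAt_transDiffeomorph,
        (extChartAt I x).right_inv hy.1]
    · exact ⟨(extChartAt I x).map_source (mem_extChartAt_source x), trivial,
        by simp only [mfld_simps]⟩
  contMDiff_invFun x := by
    refine contMDiffWithinAt_iff'.2 ⟨continuousWithinAt_id, ?_⟩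
    refine σ.symm.contDiff.contDiffWithinAt.congr_of_mem (fun y hy => ?_) ?_
    · simp only [mem_inter_iff, extChartAt_transDiffeomorph_target] at hy
      simp only [Equiv.coe_refl, Equiv.refl_symm, id, (· ∘ ·),
        coe_extChartAt_transDiffeomorph_symm, (extChartAt I x).right_inv hy.1]
    · exact ⟨(extChartAt _ x).map_source (mem_extChartAt_source x), trivial, by
        simp only [Diffeomorph.symm_apply_apply, Equiv.refl_symm, Equiv.coe_refl, mfld_simps]⟩

/-- The re-modelling diffeomorphism is the identity map. [folklore] -/
@[simp] theorem coe_toTransDiffeomorph :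
    ⇑(toTransDiffeomorph I σ hconv (M := M)) = id := rfl

end TransDiffeomorph

/-! ### The counterexample: the mapping torus of the identity of the half-line -/

namespace MappingTorusTransportCounterexample

open OpenGluingCounterexample (parabolaRegion convex_parabolaRegion isOpen_strictParabolaRegion)

/-- The model with corners `ℝ≥0 → ℝ` of the closed half-line `ℝ≥0 = [0, ∞)` (the simplest
manifold with nonempty boundary): the inclusion, with inverse `Real.toNNReal = (max · 0)`; its
range is `[0, ∞)`. (Mathlib's `𝓡∂ 1` on `EuclideanHalfSpace 1` would do as well; the inclusion
into `ℝ` keeps the coordinates readable.) [folklore] -/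
def modelHalfLine : ModelWithCorners ℝ ℝ ℝ≥0 :=
  ModelWithCorners.ofConvexRange
    { toFun := (↑)
      invFun := Real.toNNReal
      source := univ
      target := Ici 0
      map_source' := fun x _ => Set.mem_Ici.2 x.coe_nonneg
      map_target' := fun _ _ => mem_univ _
      left_inv' := fun x _ => Real.toNNReal_coe
      right_inv' := fun x hx => Real.coe_toNNReal x hx }
    rfl (convex_Ici 0) NNReal.continuous_coe continuous_real_toNNReal
    ⟨1, by
      change (1 : ℝ) ∈ interior (Ici 0)
      rw [interior_Ici]
      norm_num⟩

/-- Auxiliary (modelHalfLine apply), see the module docstring. [folklore] -/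
@[simp] theorem modelHalfLine_apply (x : ℝ≥0) : modelHalfLine x = (x : ℝ) := rfl

/-- Auxiliary (modelHalfLine symm apply), see the module docstring. [folklore] -/
@[simp] theorem modelHalfLine_symm_apply (x : ℝ) : modelHalfLine.symm x = Real.toNNReal x := rfl

/-- Auxiliary (range modelHalfLine), see the module docstring. [folklore] -/
theorem range_modelHalfLine : range modelHalfLine = Ici 0 := NNReal.range_coe

/-- The identity diffeomorphism of the half-line, whose mapping torus we take. [folklore] -/
def φ₀ : ℝ≥0 ≃ₘ⟮modelHalfLine, modelHalfLine⟯ ℝ≥0 := Diffeomorph.refl _ _ _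

/-- The mapping torus `ℝ≥0 × ℝ / ℤ` of the identity of the half-line (topologically the
half-open annulus `[0, ∞) × 𝕊¹`), i.e. `MappingTorus φ₀`. [folklore] -/
abbrev Tor : Type := MappingTorus φ₀.toHomeomorph

/-- The smooth atlas of `Tor` glued from the product atlases of the two cylinders
`ℝ≥0 × (0, 1)`, `ℝ≥0 × (1/2, 3/2)` (`MappingTorus.isManifold` of
`MappingTorusSmoothProofs`, with the trivial change of model space `f = Homeomorph.refl`), over the
model space `ModelProd ℝ≥0 ℝ`. An instance on the new type `Tor` only. [folklore] -/
instance instChartedSpaceTor : ChartedSpace (ModelProd ℝ≥0 ℝ) Tor :=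
  (MappingTorus.isOpenCover₂ φ₀.toHomeomorph).chartedSpace (Homeomorph.refl _)

/-- The product model `modelHalfLine × 𝓘(ℝ, ℝ)` on `ℝ × ℝ` (range: the half-plane `{0 ≤ u}`), the
model of the cylinders and of `Tor`. [folklore] -/
abbrev modelTor : ModelWithCorners ℝ (ℝ × ℝ) (ModelProd ℝ≥0 ℝ) := modelHalfLine.prod 𝓘(ℝ, ℝ)

/-- Auxiliary (range modelTor), see the module docstring. [folklore] -/
theorem range_modelTor : range modelTor = {w : ℝ × ℝ | 0 ≤ w.1} := by
  rw [ModelWithCorners.range_prod, range_modelHalfLine, modelWithCornersSelf_coe, range_id]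
  ext w
  simp

/-- `Tor` is a `C^∞` manifold for `modelTor` (`MappingTorus.isManifold`). An instance on the new
type `Tor` only. [folklore] -/
instance instIsManifoldTor : IsManifold modelTor ∞ Tor :=
  MappingTorus.isManifold φ₀ (Homeomorph.refl _) (ContinuousLinearEquiv.refl ℝ (ℝ × ℝ))
    (fun _ => rfl)

/-- `Tor` **is** a smooth mapping torus of `φ₀` for the model `modelTor`
(`MappingTorus.isMappingTorusOf`). [folklore] -/
theorem isMappingTorusOf_tor : IsMappingTorusOf modelTor Tor φ₀ :=
  MappingTorus.isMappingTorusOf φ₀ (Homeomorph.refl _) (ContinuousLinearEquiv.refl ℝ (ℝ × ℝ))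
    (fun _ => rfl)

/-- The bending diffeomorphism `(u, v) ↦ (v, u + v²)` of `ℝ²` (inverse `(x, y) ↦ (y - x², x)`),
mapping the half-plane `{0 ≤ u}` onto the parabola region `{x² ≤ y}`. [folklore] -/
def bend : (ℝ × ℝ) ≃ₘ[ℝ] (ℝ × ℝ) where
  toFun p := (p.2, p.1 + p.2 ^ 2)
  invFun q := (q.2 - q.1 ^ 2, q.1)
  left_inv p := by ext <;> simp
  right_inv q := by ext <;> simp
  contMDiff_toFun := contMDiff_iff_contDiff.2
    (show ContDiff ℝ ∞ (fun p : ℝ × ℝ => (p.2, p.1 + p.2 ^ 2)) by fun_prop)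
  contMDiff_invFun := contMDiff_iff_contDiff.2
    (show ContDiff ℝ ∞ (fun q : ℝ × ℝ => (q.2 - q.1 ^ 2, q.1)) by fun_prop)

/-- Auxiliary (bend apply), see the module docstring. [folklore] -/
@[simp] theorem bend_apply (p : ℝ × ℝ) : bend p = (p.2, p.1 + p.2 ^ 2) := rfl

/-- Auxiliary (bend symm apply), see the module docstring. [folklore] -/
@[simp] theorem bend_symm_apply (q : ℝ × ℝ) : bend.symm q = (q.2 - q.1 ^ 2, q.1) := rfl

/-- The bending diffeomorphism maps the half-plane `range modelTor` onto the parabola region.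
[folklore] -/
theorem image_bend_range_modelTor : bend '' range modelTor = parabolaRegion := by
  rw [range_modelTor]
  ext q
  simp only [mem_image, mem_setOf_eq, bend_apply, parabolaRegion]
  constructor
  · rintro ⟨p, hp, rfl⟩
    dsimp only
    linarith
  · intro hq
    exact ⟨(q.2 - q.1 ^ 2, q.1), by dsimp only; linarith, by ext <;> simp⟩

/-- Auxiliary (convex image bend range), see the module docstring. [folklore] -/
theorem convex_image_bend_range_modelTor : Convex ℝ (bend '' range modelTor) := by
  rw [image_bend_range_modelTor]
  exact convex_parabolaRegion

/-- **The bent model** `bend ∘ modelTor` on the same model space `ModelProd ℝ≥0 ℝ`, with range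
the parabola region `{x² ≤ y}` (`transDiffeomorph`). [folklore] -/
def modelTor' : ModelWithCorners ℝ (ℝ × ℝ) (ModelProd ℝ≥0 ℝ) :=
  transDiffeomorph modelTor bend convex_image_bend_range_modelTor

/-- Auxiliary (range modelTor'), see the module docstring. [folklore] -/
theorem range_modelTor' : range modelTor' = parabolaRegion := by
  rw [modelTor', range_transDiffeomorph, image_bend_range_modelTor]

/-- `Tor` is also a `C^∞` manifold for the bent model (`isManifold_transDiffeomorph`). An instance
on the new type `Tor` only. [folklore] -/
instance instIsManifoldTor' : IsManifold modelTor' ∞ Tor :=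
  isManifold_transDiffeomorph _ _ _

/-- The identity of `Tor` as a diffeomorphism from the model `modelTor` to the bent model
`modelTor'` (`toTransDiffeomorph`). [folklore] -/
def torDiffeo : Tor ≃ₘ⟮modelTor, modelTor'⟯ Tor :=
  toTransDiffeomorph modelTor bend convex_image_bend_range_modelTor

/-- Auxiliary (torDiffeo coe), see the module docstring. [folklore] -/
@[simp] theorem coe_torDiffeo : ⇑torDiffeo = id := rfl

/-! ### The refutation: no open smooth embedding of a cylinder into `Tor` for the bent model -/

section Refutation

variable {F : Type*} [NormedAddCommGroup F] [NormedSpace ℝ F]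
  {j : ℝ≥0 × mappingTorusPieceOne → Tor}

/-- The boundary point `(0, 1/2)` of the cylinder `ℝ≥0 × (0, 1)`. [folklore] -/
def basePt : ℝ≥0 × mappingTorusPieceOne :=
  (0, ⟨2⁻¹, MappingTorus.mem_mappingTorusPieceOne.2 ⟨by norm_num, by norm_num⟩⟩)

/-- Auxiliary (basePt fst), see the module docstring. [folklore] -/
@[simp] theorem basePt_fst : basePt.1 = 0 := rfl

/-- Auxiliary (basePt snd coe), see the module docstring. [folklore] -/
@[simp] theorem basePt_snd_coe : ((basePt.2 : mappingTorusPieceOne) : ℝ) = 2⁻¹ := rfl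

variable (h : Manifold.IsImmersionAtOfComplement F modelTor modelTor' ∞ j basePt)

/-- The linear map `u ↦ h.equiv (u, 0)` in which the immersion is written in the charts of `h`.
[folklore] -/
def linPart : (ℝ × ℝ) →L[ℝ] (ℝ × ℝ) :=
  (h.equiv : ((ℝ × ℝ) × F) →L[ℝ] (ℝ × ℝ)).comp (ContinuousLinearMap.inl ℝ (ℝ × ℝ) F)

/-- Auxiliary (linPart apply), see the module docstring. [folklore] -/
theorem linPart_apply (u : ℝ × ℝ) : linPart h u = h.equiv (u, 0) := rfl

/-- Auxiliary (mem target iff), see the module docstring. [folklore] -/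
theorem mem_target_iff {w : ℝ × ℝ} :
    w ∈ (h.domChart.extend modelTor).target ↔
      modelTor.symm w ∈ h.domChart.target ∧ 0 ≤ w.1 := by
  rw [OpenPartialHomeomorph.extend_target, range_modelTor]
  rfl

/-- On the target `V` of the extended domain chart, `linPart h` is the map `j` read in charts; in
particular it takes values in the parabola region `range modelTor'`. [folklore] -/
theorem linPart_eq {w : ℝ × ℝ} (hw : w ∈ (h.domChart.extend modelTor).target) :
    linPart h w = modelTor' (h.codChart (j ((h.domChart.extend modelTor).symm w))) := by
  have := h.writtenInCharts hw
  simp only [comp_apply, OpenPartialHomeomorph.extend_coe] at this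
  rw [linPart_apply, ← this]

/-- Auxiliary (linPart mem parabolaRegion), see the module docstring. [folklore] -/
theorem linPart_mem_parabolaRegion {w : ℝ × ℝ} (hw : w ∈ (h.domChart.extend modelTor).target) :
    linPart h w ∈ parabolaRegion := by
  rw [linPart_eq h hw, ← range_modelTor']
  exact mem_range_self _

/-- Auxiliary (linPart extend), see the module docstring. [folklore] -/
theorem linPart_extend {a : ℝ≥0 × mappingTorusPieceOne} (ha : a ∈ h.domChart.source) :
    linPart h (h.domChart.extend modelTor a) = modelTor' (h.codChart (j a)) := by
  rw [linPart_eq h ((h.domChart.extend modelTor).map_source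
    (by rwa [OpenPartialHomeomorph.extend_source])),
    OpenPartialHomeomorph.extend_left_inv _ ha]

/-- Auxiliary (extend mem target), see the module docstring. [folklore] -/
theorem extend_mem_target {a : ℝ≥0 × mappingTorusPieceOne} (ha : a ∈ h.domChart.source) :
    h.domChart.extend modelTor a ∈ (h.domChart.extend modelTor).target :=
  (h.domChart.extend modelTor).map_source (by rwa [OpenPartialHomeomorph.extend_source])

/-- Key openness step: around the image of a point of the domain chart, every point of the
parabola region close enough is a value of `linPart h` on `V` (because `j` is open and
`h.codChart` is a chart). [folklore] -/
theorem exists_ball_subset (hj : Topology.IsOpenEmbedding j) {a : ℝ≥0 × mappingTorusPieceOne}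
    (ha : a ∈ h.domChart.source) :
    ∃ ε > 0, ∀ q : ℝ × ℝ, dist q (modelTor' (h.codChart (j a))) < ε → q ∈ parabolaRegion →
      q ∈ linPart h '' (h.domChart.extend modelTor).target := by
  set S : Set (ModelProd ℝ≥0 ℝ) := h.codChart '' (j '' h.domChart.source) with hS
  have hSo : IsOpen S := h.codChart.isOpen_image_of_subset_source
    (hj.isOpenMap _ h.domChart.open_source) (image_subset_iff.2 h.source_subset_preimage_source)
  have hO : IsOpen (modelTor'.symm ⁻¹' S) := modelTor'.continuous_symm.isOpen_preimage _ hSo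
  have hq : modelTor' (h.codChart (j a)) ∈ modelTor'.symm ⁻¹' S := by
    rw [mem_preimage, ModelWithCorners.left_inv]
    exact ⟨j a, ⟨a, ha, rfl⟩, rfl⟩
  obtain ⟨ε, hε, hball⟩ := Metric.isOpen_iff.1 hO _ hq
  refine ⟨ε, hε, fun q hqd hqP => ?_⟩
  have hq' : modelTor'.symm q ∈ S := hball (by rwa [Metric.mem_ball])
  obtain ⟨_, ⟨a', ha', rfl⟩, ha'q⟩ := hq'
  refine ⟨h.domChart.extend modelTor a', extend_mem_target h ha', ?_⟩
  rw [linPart_extend h ha', ha'q, ModelWithCorners.right_inv]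
  rwa [range_modelTor']

/-- Step 1: the linear part is surjective (its range contains an open piece of the parabola
region). [folklore] -/
theorem linPart_surjective (hj : Topology.IsOpenEmbedding j) : Surjective (linPart h) := by
  obtain ⟨ε, hε, hball⟩ := exists_ball_subset h hj h.mem_domChart_source
  set q₀ : ℝ × ℝ := modelTor' (h.codChart (j basePt)) with hq₀
  have hq₀P : q₀ ∈ parabolaRegion := by rw [← range_modelTor']; exact mem_range_self _
  have hq₀P' : q₀.1 ^ 2 ≤ q₀.2 := hq₀P
  set c : ℝ × ℝ := (q₀.1, q₀.2 + ε / 2) with hc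
  set W : Set (ℝ × ℝ) := Metric.ball q₀ ε ∩ {q | q.1 ^ 2 < q.2} with hW
  have hWo : IsOpen W := Metric.isOpen_ball.inter isOpen_strictParabolaRegion
  have hcW : c ∈ W := by
    refine ⟨?_, ?_⟩
    · rw [Metric.mem_ball, Prod.dist_eq, hc]
      simp only [dist_self]
      rw [Real.dist_eq, show q₀.2 + ε / 2 - q₀.2 = ε / 2 by ring, abs_of_pos (half_pos hε),
        max_eq_right (half_pos hε).le]
      exact half_lt_self hε
    · show q₀.1 ^ 2 < q₀.2 + ε / 2
      linarith
  have hsub : W ⊆ range (linPart h) := by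
    rintro q ⟨hq1, hq2⟩
    obtain ⟨u, -, hu⟩ := hball q (Metric.mem_ball.1 hq1) (le_of_lt (show q.1 ^ 2 < q.2 from hq2))
    exact ⟨u, hu⟩
  have htop : LinearMap.range (linPart h : (ℝ × ℝ) →ₗ[ℝ] (ℝ × ℝ)) = ⊤ := by
    apply Submodule.eq_top_of_nonempty_interior'
    exact ⟨c, mem_interior_iff_mem_nhds.2 (Filter.mem_of_superset (hWo.mem_nhds hcW) hsub)⟩
  exact LinearMap.range_eq_top.1 htop

/-- Auxiliary (linPart injective), see the module docstring. [folklore] -/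
theorem linPart_injective (hj : Topology.IsOpenEmbedding j) : Injective (linPart h) :=
  LinearMap.injective_iff_surjective.2 (linPart_surjective h hj)

/-- The target `V` of the extended domain chart is a neighbourhood (in `ℝ²`) of each of its points
in the open half-plane `{0 < u}`. [folklore] -/
theorem target_mem_nhds {w : ℝ × ℝ} (hw : w ∈ (h.domChart.extend modelTor).target)
    (hw' : 0 < w.1) : (h.domChart.extend modelTor).target ∈ 𝓝 w := by
  rw [OpenPartialHomeomorph.extend_target, range_modelTor]
  rw [mem_target_iff] at hw
  refine Filter.inter_mem ?_ ?_
  · exact (modelTor.continuous_symm.isOpen_preimage _ h.domChart.open_target).mem_nhds hw.1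
  · exact Filter.mem_of_superset ((isOpen_lt continuous_const continuous_fst).mem_nhds hw')
      (fun p (hp : 0 < p.1) => (le_of_lt hp : 0 ≤ p.1))

/-- The preferred chart of the cylinder `ℝ≥0 × (0, 1)` at any point has source `univ`
(product of the identity chart of `ℝ≥0` and the inclusion chart of `(0, 1) ⊆ ℝ`). [folklore] -/
theorem chartAt_source_eq_univ (a : ℝ≥0 × mappingTorusPieceOne) :
    (chartAt (ModelProd ℝ≥0 ℝ) a).source = univ := by
  simp [TopologicalSpace.Opens.chartAt_eq]

/-- The preferred extended chart of the cylinder `ℝ≥0 × (0, 1)` is the coordinate map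
`(x, s) ↦ (x, s)`. [folklore] -/
theorem extChartAt_apply (a b : ℝ≥0 × mappingTorusPieceOne) :
    extChartAt modelTor a b = ((b.1 : ℝ), (b.2 : ℝ)) := by
  simp [extChartAt, TopologicalSpace.Opens.chartAt_eq]

/-- Step 2: the boundary point `basePt = (0, 1/2)` is sent by the extended domain chart to a point
of the boundary line `{u = 0}` of the half-plane (not into the open half-plane): otherwise the
inverse extended chart followed by the coordinate map of the cylinder would be a differentiable
map on a neighbourhood, with nonnegative first component vanishing at that point, so with a
non-injective derivative, contradicting the existence of the (within-)differentiable left inverse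
given by the chart. [folklore] -/
theorem fst_extend_basePt_eq_zero : (h.domChart.extend modelTor basePt).1 = 0 := by
  set φ := h.domChart.extend modelTor with hφ
  set v₀ := φ basePt with hv₀
  have hv₀V : v₀ ∈ φ.target := extend_mem_target h h.mem_domChart_source
  have hle : 0 ≤ v₀.1 := ((mem_target_iff h).1 hv₀V).2
  by_contra hne
  have hlt : 0 < v₀.1 := lt_of_le_of_ne hle (Ne.symm hne)
  have hVn : φ.target ∈ 𝓝 v₀ := target_mem_nhds h hv₀V hlt
  -- the coordinate chart of the cylinder
  set κ := extChartAt modelTor basePt with hκ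
  have hκs : κ.source = univ := by
    rw [hκ, extChartAt_source, chartAt_source_eq_univ]
  have hκa : ∀ b, κ b = ((b.1 : ℝ), (b.2 : ℝ)) := extChartAt_apply basePt
  -- the inverse extended chart followed by the coordinates, as a map `ℝ² → ℝ²`
  set G : ℝ × ℝ → ℝ × ℝ := κ ∘ φ.symm with hG
  have hGs : ContMDiffOn 𝓘(ℝ, ℝ × ℝ) 𝓘(ℝ, ℝ × ℝ) ∞ G φ.target := by
    have h1 := contMDiffOn_extend_symm h.domChart_mem_maximalAtlas (I := modelTor)
    rw [← OpenPartialHomeomorph.extend_target'] at h1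
    have h2 : ContMDiffOn modelTor 𝓘(ℝ, ℝ × ℝ) ∞ κ univ := by
      rw [← chartAt_source_eq_univ basePt]
      exact contMDiffOn_extChartAt
    exact h2.comp h1 (mapsTo_univ _ _)
  rw [contMDiffOn_iff_contDiffOn] at hGs
  have hGd : HasFDerivAt G (fderiv ℝ G v₀) v₀ :=
    (((hGs v₀ hv₀V).contDiffAt hVn).differentiableAt (by simp)).hasFDerivAt
  set D := fderiv ℝ G v₀ with hD
  have hGv₀ : G v₀ = (0, 2⁻¹) := by
    simp only [hG, comp_apply, hv₀]
    rw [OpenPartialHomeomorph.extend_left_inv _ h.mem_domChart_source, hκa]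
    rfl
  -- the first component of `G` has a minimum at `v₀`
  have hmin : IsLocalMin (fun u => (G u).1) v₀ := by
    refine Filter.Eventually.of_forall (fun u => ?_)
    show (G v₀).1 ≤ (G u).1
    rw [hGv₀]
    show (0 : ℝ) ≤ (κ (φ.symm u)).1
    rw [hκa]
    exact NNReal.coe_nonneg _
  have hD1 : (ContinuousLinearMap.fst ℝ ℝ ℝ).comp D = 0 := hmin.hasFDerivAt_eq_zero hGd.fst
  -- the chart is a left inverse of `G`, differentiable within a suitable set
  set Φ : ℝ × ℝ → ℝ × ℝ := φ ∘ κ.symm with hΦ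
  set T : Set (ℝ × ℝ) := κ.target ∩ κ.symm ⁻¹' h.domChart.source with hT
  have hΦs : ContMDiffOn 𝓘(ℝ, ℝ × ℝ) 𝓘(ℝ, ℝ × ℝ) ∞ Φ T := by
    have h1 : ContMDiffOn 𝓘(ℝ, ℝ × ℝ) modelTor ∞ κ.symm κ.target :=
      contMDiffOn_extChartAt_symm basePt
    exact (OpenPartialHomeomorph.contMDiffOn_extend h.domChart_mem_maximalAtlas).comp
      (h1.mono inter_subset_left) (fun u hu => hu.2)
  rw [contMDiffOn_iff_contDiffOn] at hΦs
  have hmaps : MapsTo G φ.target T := by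
    intro u hu
    have hsrc : φ.symm u ∈ h.domChart.source := by
      have := φ.map_target hu
      rwa [OpenPartialHomeomorph.extend_source] at this
    refine ⟨κ.map_source (by rw [hκs]; exact mem_univ _), ?_⟩
    show κ.symm (κ (φ.symm u)) ∈ h.domChart.source
    rw [κ.left_inv (by rw [hκs]; exact mem_univ _)]
    exact hsrc
  have h0T : G v₀ ∈ T := hmaps hv₀V
  have hΦd : HasFDerivWithinAt Φ (fderivWithin ℝ Φ T (G v₀)) T (G v₀) :=
    ((hΦs _ h0T).differentiableWithinAt (by simp)).hasFDerivWithinAt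
  have hcomp : HasFDerivAt (Φ ∘ G) ((fderivWithin ℝ Φ T (G v₀)).comp D) v₀ :=
    (hΦd.comp v₀ hGd.hasFDerivWithinAt hmaps).hasFDerivAt hVn
  have hid : HasFDerivAt (id : ℝ × ℝ → ℝ × ℝ) ((fderivWithin ℝ Φ T (G v₀)).comp D) v₀ := by
    refine hcomp.congr_of_eventuallyEq ?_
    filter_upwards [hVn] with u hu
    simp only [id_eq, hΦ, hG, comp_apply]
    rw [κ.left_inv (by rw [hκs]; exact mem_univ _)]
    exact (φ.right_inv hu).symm
  have hcompid : (fderivWithin ℝ Φ T (G v₀)).comp D = ContinuousLinearMap.id ℝ (ℝ × ℝ) :=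
    hid.unique (hasFDerivAt_id v₀)
  -- hence `D` is injective, hence surjective, contradicting `fst ∘ D = 0`
  have hDinj : Injective D := by
    intro x y hxy
    have hx := congrArg (fun f : (ℝ × ℝ) →L[ℝ] (ℝ × ℝ) => f x) hcompid
    have hy := congrArg (fun f : (ℝ × ℝ) →L[ℝ] (ℝ × ℝ) => f y) hcompid
    simp only [ContinuousLinearMap.coe_comp, comp_apply, ContinuousLinearMap.coe_id',
      id_eq] at hx hy
    rw [← hx, ← hy, hxy]
  have hDsurj : Surjective (D : (ℝ × ℝ) →ₗ[ℝ] (ℝ × ℝ)) :=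
    LinearMap.injective_iff_surjective.1 hDinj
  obtain ⟨x, hx⟩ := hDsurj (1, 0)
  have hx' : D x = (1, 0) := hx
  have := DFunLike.congr_fun hD1 x
  rw [ContinuousLinearMap.comp_apply, hx'] at this
  simp at this

/-- Step 3a: at every point `(0, y)` of the boundary line lying in the target `V` of the extended
domain chart, the linear part takes a value on the parabola `x² = y`: otherwise its value would be
an interior point of the parabola region, a whole neighbourhood of it would consist of values of
`linPart h` on `V` (step "openness"), and by injectivity the points `(-t, y)`, `t > 0` small,
would lie in `V ⊆ {0 ≤ u}`. [folklore] -/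
theorem linPart_boundary_mem_parabola (hj : Topology.IsOpenEmbedding j) {y : ℝ}
    (hy : ((0, y) : ℝ × ℝ) ∈ (h.domChart.extend modelTor).target) :
    (linPart h (0, y)).1 ^ 2 = (linPart h (0, y)).2 := by
  set φ := h.domChart.extend modelTor with hφ
  have hle : (linPart h (0, y)).1 ^ 2 ≤ (linPart h (0, y)).2 := linPart_mem_parabolaRegion h hy
  rcases hle.eq_or_lt with heq | hpos
  · exact heq
  exfalso
  set a : ℝ≥0 × mappingTorusPieceOne := φ.symm (0, y) with ha
  have haU : a ∈ h.domChart.source := by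
    have := φ.map_target hy
    rwa [OpenPartialHomeomorph.extend_source] at this
  obtain ⟨ε, hε, hball⟩ := exists_ball_subset h hj haU
  have hq : modelTor' (h.codChart (j a)) = linPart h (0, y) := (linPart_eq h hy).symm
  rw [hq] at hball
  -- points just left of the boundary line are mapped close to `linPart h (0, y)`
  have htend : Filter.Tendsto (fun t : ℝ => linPart h (-t, y)) (𝓝[>] 0)
      (𝓝 (linPart h (0, y))) := by
    have : Continuous (fun t : ℝ => linPart h (-t, y)) := by fun_prop
    have h0 := this.tendsto 0
    simp only [neg_zero] at h0
    exact h0.mono_left nhdsWithin_le_nhds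
  have hnhds : {q : ℝ × ℝ | dist q (linPart h (0, y)) < ε ∧ q.1 ^ 2 < q.2} ∈
      𝓝 (linPart h (0, y)) := by
    refine Filter.inter_mem (Metric.ball_mem_nhds _ hε) ?_
    exact isOpen_strictParabolaRegion.mem_nhds hpos
  have hev := (htend.eventually hnhds).and (self_mem_nhdsWithin : Ioi (0 : ℝ) ∈ 𝓝[>] (0 : ℝ))
  obtain ⟨t, ⟨ht1, ht2⟩, ht⟩ := hev.exists
  obtain ⟨u, hu, hut⟩ := hball _ ht1 (le_of_lt ht2 : (linPart h (-t, y)).1 ^ 2 ≤ _)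
  have huq : u = (-t, y) := linPart_injective h hj hut
  rw [huq] at hu
  have : (0 : ℝ) ≤ -t := ((mem_target_iff h).1 hu).2
  have ht' : (0 : ℝ) < t := ht
  linarith

include h in
/-- Step 3b: contradiction. The boundary point `basePt` is charted onto a point `(0, s)` of the
boundary line; nearby points `(0, y)` of that line lie in the target `V`; by linearity
`linPart h (0, y) = y • (a, b)` lies on the parabola, i.e. `a² y² = b y` for all `y` near `s`,
which forces `a = b = 0`, contradicting the injectivity of `linPart h`. [folklore] -/
theorem false_of_isImmersionAt (hj : Topology.IsOpenEmbedding j) : False := by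
  set φ := h.domChart.extend modelTor with hφ
  set v₀ := φ basePt with hv₀
  have hv₀V : v₀ ∈ φ.target := extend_mem_target h h.mem_domChart_source
  have hfst : v₀.1 = 0 := fst_extend_basePt_eq_zero h
  set s := v₀.2 with hs
  have hv₀eq : v₀ = (0, s) := Prod.ext hfst rfl
  -- boundary points near `v₀` lie in the target
  have hO : IsOpen (modelTor.symm ⁻¹' h.domChart.target) :=
    modelTor.continuous_symm.isOpen_preimage _ h.domChart.open_target
  have hγ : Continuous (fun y : ℝ => ((0, y) : ℝ × ℝ)) := by fun_prop
  have hev : ∀ᶠ y in 𝓝 s, ((0, y) : ℝ × ℝ) ∈ φ.target := by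
    have h1 : ((0, s) : ℝ × ℝ) ∈ modelTor.symm ⁻¹' h.domChart.target := by
      rw [← hv₀eq]; exact ((mem_target_iff h).1 hv₀V).1
    filter_upwards [hγ.continuousAt.preimage_mem_nhds (hO.mem_nhds h1)] with y hy
    exact (mem_target_iff h).2 ⟨hy, le_refl _⟩
  -- the polynomial `a² y² - b y` vanishes near `s`
  set a := (linPart h (0, 1)).1 with ha
  set b := (linPart h (0, 1)).2 with hb
  have hlin : ∀ y : ℝ, linPart h (0, y) = (y * a, y * b) := by
    intro y
    have : ((0, y) : ℝ × ℝ) = y • ((0, 1) : ℝ × ℝ) := by ext <;> simp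
    rw [this, map_smul]
    ext <;> simp [ha, hb]
  have hpoly : ∀ᶠ y in 𝓝 s, (y * a) ^ 2 = y * b := by
    filter_upwards [hev] with y hy
    have := linPart_boundary_mem_parabola h hj hy
    rwa [hlin y] at this
  obtain ⟨δ, hδ, hδball⟩ := Metric.eventually_nhds_iff.1 hpoly
  have e0 := hδball (y := s) (by simpa using hδ)
  have e1 := hδball (y := s + δ / 2) (by
    rw [Real.dist_eq, show s + δ / 2 - s = δ / 2 by ring, abs_of_pos (half_pos hδ)]
    exact half_lt_self hδ)
  have e2 := hδball (y := s - δ / 2) (by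
    rw [Real.dist_eq, show s - δ / 2 - s = -(δ / 2) by ring, abs_neg, abs_of_pos (half_pos hδ)]
    exact half_lt_self hδ)
  have ha0 : a = 0 := by
    have h2 : a ^ 2 * ((δ / 2) ^ 2 * 2) = 0 := by linear_combination e1 + e2 - 2 * e0
    have hδ2 : (δ / 2) ^ 2 * 2 ≠ 0 := by positivity
    have : a ^ 2 = 0 := (mul_eq_zero.1 h2).resolve_right hδ2
    exact pow_eq_zero_iff (n := 2) (by norm_num) |>.1 this
  have hb0 : b = 0 := by
    have h2 : (δ / 2) * b = 0 := by
      linear_combination -(e1 - e0) + (2 * s * (δ / 2) + (δ / 2) ^ 2) * a * ha0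
    exact (mul_eq_zero.1 h2).resolve_left (ne_of_gt (half_pos hδ))
  -- contradiction with injectivity
  have h01 : linPart h (0, 1) = linPart h 0 := by
    rw [map_zero, hlin 1]
    simp [ha0, hb0]
  have := linPart_injective h hj h01
  simp at this

end Refutation

/-- **There is no open smooth embedding of the cylinder `ℝ≥0 × (0, 1)` into `Tor` for the
bent model `modelTor'`**: such an embedding cannot be an immersion (in Mathlib's chart-wise linear
sense) at the boundary point `basePt`. [folklore] -/
theorem not_isSmoothEmbedding_of_isOpen_range {j : ℝ≥0 × mappingTorusPieceOne → Tor}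
    (hj : Manifold.IsSmoothEmbedding modelTor modelTor' ∞ j) (hjo : IsOpen (range j)) : False := by
  obtain ⟨F, _, _, h⟩ := hj.isImmersion.isImmersionAt basePt
  exact false_of_isImmersionAt h ⟨hj.isEmbedding, hjo⟩

/-- `Tor` with the bent model `modelTor'` is **not** a smooth mapping torus of `φ₀`, although it
is diffeomorphic (`torDiffeo`, the identity) to `Tor` with the model `modelTor`, which is one
(`isMappingTorusOf_tor`). [folklore] -/
theorem not_isMappingTorusOf_tor' : ¬ IsMappingTorusOf modelTor' Tor φ₀ := by
  rintro ⟨jA, jB, hA, hAo, -, -, -, -⟩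
  exact not_isSmoothEmbedding_of_isOpen_range hA hAo

/-- **The named fact `Literature.Topology.FourManifolds.IsMappingTorusOf.of_diffeomorph` is false**: its instance with
`M = ℝ≥0` (model `modelHalfLine`), `φ = φ₀ = id`, `T = T' = Tor`, `IT = modelTor`,
`IT' = modelTor'` fails, by `isMappingTorusOf_tor`, the diffeomorphism
`torDiffeo : Tor ≃ₘ⟮modelTor, modelTor'⟯ Tor` and `not_isMappingTorusOf_tor'` (both `IsManifold`
instance hypotheses of the fact are genuine instances here, `instIsManifoldTor`,
`instIsManifoldTor'`). The corrected statement is `IsMappingTorusOf.of_diffeomorph_of_range_eq`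
(file `MappingTorusTransportProofs`). [folklore] -/
theorem not_isMappingTorusOf_of_diffeomorph :
    ¬ IsMappingTorusOf.of_diffeomorph (I := modelHalfLine) (IT := modelTor) (IT' := modelTor')
      (M := ℝ≥0) (T := Tor) (T' := Tor) :=
  fun H => not_isMappingTorusOf_tor' (H isMappingTorusOf_tor torDiffeo)

/-- The refuted instance, unfolded: it is the statement `∀ φ, IsMappingTorusOf modelTor Tor φ →
(Tor ≃ₘ⟮modelTor, modelTor'⟯ Tor) → IsMappingTorusOf modelTor' Tor φ` (the instance arguments
of the fact being supplied by `instIsManifoldTor`, `instIsManifoldTor'`), and it fails at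
`φ = φ₀`, `e = torDiffeo`. [folklore] -/
theorem not_forall_isMappingTorusOf_imp :
    ¬ ∀ {φ : ℝ≥0 ≃ₘ⟮modelHalfLine, modelHalfLine⟯ ℝ≥0},
        IsMappingTorusOf modelTor Tor φ → (Tor ≃ₘ⟮modelTor, modelTor'⟯ Tor) →
          IsMappingTorusOf modelTor' Tor φ :=
  fun H => not_isMappingTorusOf_tor' (H isMappingTorusOf_tor torDiffeo)

end MappingTorusTransportCounterexample

end Literature.Topology.FourManifolds
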